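import Summits.AnomalousDissipation.AnomalousDissipation.Theorems.SolenoidalFractalHomogenisationLagrangianStepLossCurrencyComparability

/-!
# K1L_D (stmt-AnomalousDissipation-27980) glue v2, steps (b)(c): the COMPOSE KIT — abstract Hilbert-space algebra

For the §9z glue `cellInputs_BIL_of` v2 (memo L12 §3, lead-k1l-onelevel-p1 g5): after step (a) gives the per-piece Eulerian loss bounds
`|⟪(Uᵢ − Tᵢ)x, ζ⟫| ≤ ηᵢ √q_{Tᵢ}(x) √q*_{Tᵢ}(ζ)` on the two refresh sub-windows, the N-conversions are REAL-NUMBER hypotheses on the four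
losses and everything else is algebra.  This file supplies that algebra once, over any real Hilbert space:

* `lossBound_onePiece` — one window: `q_T(x) ≤ A`, `q*_T(ζ) ≤ B` ⇒ `|⟪(U−T)x,ζ⟫| ≤ η √A √B`;
* `lossBound_twoPiece` — two windows via `lossBound_comp_raw`: with `q_{T₂T₁}(x) ≤ A`, `q*_{T₂T₁}(ζ) ≤ B` and the loss-rate
  monotonicity `q_{T₂}(T₁x) ≤ μ·q_{T₁}(x)` ((N2), `loss_later_le_of_expBound`):
  `|⟪U₂(U₁x) − T₂(T₁x), ζ⟫| ≤ (η₂·√(2μ + 2η₁²) + η₁)·√A·√B`, and the split form `(η₂√(2μ) + √2·η₂η₁ + η₁)·√A·√B`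
  (the CAPPED η₂ of (V_modEC) keeps `√2·η₂η₁` harmless; `η₂√(2μ)` carries the `√(τ₂/R)` gain);
* `lossBound_of_range` — a bound proved on the range of a self-adjoint contraction `P` (div-free data) with `U = U∘P = P∘U`,
  `T = T∘P = P∘T` holds for ALL data (`q_T(Px) ≤ q_T(x)`, `q*_T(Pζ) ≤ q*_T(ζ)`);
* `lossBound_transfer` — the three identities of `FrameConjugacyAt` move a cell-side bound to the Eulerian pair verbatim.

Pure algebra; NOT a proof of the glue, of (V_modEC), of the crux, or of AD.  Cell ad-ideate, planner ad-ideate-p5 g14 (certifier).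

Port note (prover ad-k1loc-p3 g8, `--supports 27980 --as helper`): p5 g14's crux workfile `Lines/onelevel_compose_kit.lean` (sha16 e016343f81a2d0a1,
rc 0) VERBATIM modulo the namespace (now `…LagrangianStep.LossCurrency`, with `…LossCurrency` p690895 / `…LossCurrencyComparability` p692467 (+ lead g5's
amendment `lossBound_comp_raw`) / `…LossQuasiMonotone` p693776).
-/

set_option linter.dupNamespace false

noncomputable section

namespace Summit.AnomalousDissipation.AnomalousDissipation.Theorems.SolenoidalFractalHomogenisation.LagrangianStep.LossCurrency

open scoped InnerProductSpace

variable {H : Type*} [NormedAddCommGroup H] [InnerProductSpace ℝ H] [CompleteSpace H]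

/-! ## §1 One window -/

/-- ONE WINDOW with N-conversions as real hypotheses: `q_T(x) ≤ A`, `q*_T(ζ) ≤ B` ⇒ `|⟪(U−T)x,ζ⟫| ≤ η √A √B`. [folklore] -/
theorem lossBound_onePiece {U T : H →L[ℝ] H} {η A B : ℝ} (hη : 0 ≤ η) {x ζ : H}
    (h : |⟪U x - T x, ζ⟫_ℝ| ≤ η * Real.sqrt (‖x‖ ^ 2 - ‖T x‖ ^ 2) * Real.sqrt (‖ζ‖ ^ 2 - ‖ContinuousLinearMap.adjoint T ζ‖ ^ 2))
    (hA : ‖x‖ ^ 2 - ‖T x‖ ^ 2 ≤ A) (hB : ‖ζ‖ ^ 2 - ‖ContinuousLinearMap.adjoint T ζ‖ ^ 2 ≤ B) :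
    |⟪U x - T x, ζ⟫_ℝ| ≤ η * Real.sqrt A * Real.sqrt B := by
  have h1 : Real.sqrt (‖x‖ ^ 2 - ‖T x‖ ^ 2) ≤ Real.sqrt A := Real.sqrt_le_sqrt hA
  have h2 : Real.sqrt (‖ζ‖ ^ 2 - ‖ContinuousLinearMap.adjoint T ζ‖ ^ 2) ≤ Real.sqrt B := Real.sqrt_le_sqrt hB
  calc |⟪U x - T x, ζ⟫_ℝ| ≤ η * Real.sqrt (‖x‖ ^ 2 - ‖T x‖ ^ 2) * Real.sqrt (‖ζ‖ ^ 2 - ‖ContinuousLinearMap.adjoint T ζ‖ ^ 2) := h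
    _ ≤ η * Real.sqrt A * Real.sqrt B := by
        apply mul_le_mul (mul_le_mul_of_nonneg_left h1 hη) h2 (Real.sqrt_nonneg _)
        exact mul_nonneg hη (Real.sqrt_nonneg _)

/-! ## §2 Two windows (composition across the refresh boundary) -/

/-- `√(a + b) ≤ √a + √b` for `0 ≤ a, b` (private at port time: the public name is already landed as
`Literature.NumberTheory.LFunctions.MRT2015.sqrt_add_le_sqrt_add_sqrt`, gate `dedup.landed`; not imported here to keep the fluid files free of
the L-function chapter). [folklore] -/
private theorem sqrt_add_le_sqrt_add_sqrt {a b : ℝ} (ha : 0 ≤ a) (hb : 0 ≤ b) : Real.sqrt (a + b) ≤ Real.sqrt a + Real.sqrt b := by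
  have hs : 0 ≤ Real.sqrt a + Real.sqrt b := add_nonneg (Real.sqrt_nonneg _) (Real.sqrt_nonneg _)
  have hsq : a + b ≤ (Real.sqrt a + Real.sqrt b) ^ 2 := by
    have h1 := Real.sq_sqrt ha
    have h2 := Real.sq_sqrt hb
    nlinarith [mul_nonneg (Real.sqrt_nonneg a) (Real.sqrt_nonneg b)]
  calc Real.sqrt (a + b) ≤ Real.sqrt ((Real.sqrt a + Real.sqrt b) ^ 2) := Real.sqrt_le_sqrt hsq
    _ = Real.sqrt a + Real.sqrt b := Real.sqrt_sq hs

/-- **TWO WINDOWS**: per-piece loss bounds `η₁` (first window `(U₁,T₁)`) and `η₂` (second window `(U₂,T₂)`), the composite N-conversions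
`q_{T₂T₁}(x) ≤ A`, `q*_{T₂T₁}(ζ) ≤ B`, and the loss-rate monotonicity `q_{T₂}(T₁x) ≤ μ·q_{T₁}(x)` (N2) give
`|⟪U₂(U₁x) − T₂(T₁x), ζ⟫| ≤ (η₂·√(2μ + 2η₁²) + η₁)·√A·√B`.  Uses `lossBound_comp_raw` (short window keeps its own losses) and the
monotonicities `loss_le_loss_comp`, `lossAdj_le_lossAdj_comp`, `lossAdj_adjoint_le_lossAdj_comp`. [folklore] -/
theorem lossBound_twoPiece {U₁ T₁ U₂ T₂ : H →L[ℝ] H} {η₁ η₂ μ A B : ℝ} (hη₁ : 0 ≤ η₁) (hη₂ : 0 ≤ η₂) (hμ : 0 ≤ μ)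
    (hT₁ : ∀ y, ‖T₁ y‖ ≤ ‖y‖) (hT₂ : ∀ y, ‖T₂ y‖ ≤ ‖y‖)
    (h₁ : ∀ x ζ : H, |⟪U₁ x - T₁ x, ζ⟫_ℝ| ≤ η₁ * Real.sqrt (‖x‖ ^ 2 - ‖T₁ x‖ ^ 2) * Real.sqrt (‖ζ‖ ^ 2 - ‖ContinuousLinearMap.adjoint T₁ ζ‖ ^ 2))
    (h₂ : ∀ x ζ : H, |⟪U₂ x - T₂ x, ζ⟫_ℝ| ≤ η₂ * Real.sqrt (‖x‖ ^ 2 - ‖T₂ x‖ ^ 2) * Real.sqrt (‖ζ‖ ^ 2 - ‖ContinuousLinearMap.adjoint T₂ ζ‖ ^ 2))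
    {x ζ : H} (hA : ‖x‖ ^ 2 - ‖(T₂.comp T₁) x‖ ^ 2 ≤ A)
    (hB : ‖ζ‖ ^ 2 - ‖ContinuousLinearMap.adjoint (T₂.comp T₁) ζ‖ ^ 2 ≤ B)
    (hmono : ‖T₁ x‖ ^ 2 - ‖T₂ (T₁ x)‖ ^ 2 ≤ μ * (‖x‖ ^ 2 - ‖T₁ x‖ ^ 2)) :
    |⟪U₂ (U₁ x) - T₂ (T₁ x), ζ⟫_ℝ| ≤ (η₂ * Real.sqrt (2 * μ + 2 * η₁ ^ 2) + η₁) * Real.sqrt A * Real.sqrt B := by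
  have hraw := lossBound_comp_raw hη₁ hη₂ hT₁ hT₂ h₁ h₂ x ζ
  -- the four losses and their conversions
  have hq1nn : 0 ≤ ‖x‖ ^ 2 - ‖T₁ x‖ ^ 2 := loss_nonneg hT₁ x
  have hq1A : ‖x‖ ^ 2 - ‖T₁ x‖ ^ 2 ≤ A := (loss_le_loss_comp hT₂ x).trans hA
  have hqs2B : ‖ζ‖ ^ 2 - ‖ContinuousLinearMap.adjoint T₂ ζ‖ ^ 2 ≤ B := (lossAdj_le_lossAdj_comp hT₁ ζ).trans hB
  have hqs12B : ‖ContinuousLinearMap.adjoint T₂ ζ‖ ^ 2 - ‖ContinuousLinearMap.adjoint T₁ (ContinuousLinearMap.adjoint T₂ ζ)‖ ^ 2 ≤ B :=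
    (lossAdj_adjoint_le_lossAdj_comp hT₂ ζ).trans hB
  have hc : 0 ≤ 2 * μ + 2 * η₁ ^ 2 := by positivity
  have hin : 2 * (‖T₁ x‖ ^ 2 - ‖T₂ (T₁ x)‖ ^ 2) + 2 * η₁ ^ 2 * (‖x‖ ^ 2 - ‖T₁ x‖ ^ 2) ≤ (2 * μ + 2 * η₁ ^ 2) * A := by
    have hA0 : 0 ≤ A := hq1nn.trans hq1A
    calc 2 * (‖T₁ x‖ ^ 2 - ‖T₂ (T₁ x)‖ ^ 2) + 2 * η₁ ^ 2 * (‖x‖ ^ 2 - ‖T₁ x‖ ^ 2)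
        ≤ 2 * (μ * (‖x‖ ^ 2 - ‖T₁ x‖ ^ 2)) + 2 * η₁ ^ 2 * (‖x‖ ^ 2 - ‖T₁ x‖ ^ 2) := by linarith
      _ = (2 * μ + 2 * η₁ ^ 2) * (‖x‖ ^ 2 - ‖T₁ x‖ ^ 2) := by ring
      _ ≤ (2 * μ + 2 * η₁ ^ 2) * A := mul_le_mul_of_nonneg_left hq1A hc
  have hs1 : Real.sqrt (2 * (‖T₁ x‖ ^ 2 - ‖T₂ (T₁ x)‖ ^ 2) + 2 * η₁ ^ 2 * (‖x‖ ^ 2 - ‖T₁ x‖ ^ 2))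
      ≤ Real.sqrt (2 * μ + 2 * η₁ ^ 2) * Real.sqrt A := by
    rw [← Real.sqrt_mul hc]
    exact Real.sqrt_le_sqrt hin
  have hs2 : Real.sqrt (‖ζ‖ ^ 2 - ‖ContinuousLinearMap.adjoint T₂ ζ‖ ^ 2) ≤ Real.sqrt B := Real.sqrt_le_sqrt hqs2B
  have hs3 : Real.sqrt (‖x‖ ^ 2 - ‖T₁ x‖ ^ 2) ≤ Real.sqrt A := Real.sqrt_le_sqrt hq1A
  have hs4 : Real.sqrt (‖ContinuousLinearMap.adjoint T₂ ζ‖ ^ 2 - ‖ContinuousLinearMap.adjoint T₁ (ContinuousLinearMap.adjoint T₂ ζ)‖ ^ 2)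
      ≤ Real.sqrt B := Real.sqrt_le_sqrt hqs12B
  have t1 : η₂ * Real.sqrt (2 * (‖T₁ x‖ ^ 2 - ‖T₂ (T₁ x)‖ ^ 2) + 2 * η₁ ^ 2 * (‖x‖ ^ 2 - ‖T₁ x‖ ^ 2))
        * Real.sqrt (‖ζ‖ ^ 2 - ‖ContinuousLinearMap.adjoint T₂ ζ‖ ^ 2)
      ≤ η₂ * (Real.sqrt (2 * μ + 2 * η₁ ^ 2) * Real.sqrt A) * Real.sqrt B := by
    apply mul_le_mul (mul_le_mul_of_nonneg_left hs1 hη₂) hs2 (Real.sqrt_nonneg _)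
    exact mul_nonneg hη₂ (mul_nonneg (Real.sqrt_nonneg _) (Real.sqrt_nonneg _))
  have t2 : η₁ * Real.sqrt (‖x‖ ^ 2 - ‖T₁ x‖ ^ 2)
        * Real.sqrt (‖ContinuousLinearMap.adjoint T₂ ζ‖ ^ 2 - ‖ContinuousLinearMap.adjoint T₁ (ContinuousLinearMap.adjoint T₂ ζ)‖ ^ 2)
      ≤ η₁ * Real.sqrt A * Real.sqrt B := by
    apply mul_le_mul (mul_le_mul_of_nonneg_left hs3 hη₁) hs4 (Real.sqrt_nonneg _)
    exact mul_nonneg hη₁ (Real.sqrt_nonneg _)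
  calc |⟪U₂ (U₁ x) - T₂ (T₁ x), ζ⟫_ℝ| ≤ _ := hraw
    _ ≤ η₂ * (Real.sqrt (2 * μ + 2 * η₁ ^ 2) * Real.sqrt A) * Real.sqrt B + η₁ * Real.sqrt A * Real.sqrt B := add_le_add t1 t2
    _ = (η₂ * Real.sqrt (2 * μ + 2 * η₁ ^ 2) + η₁) * Real.sqrt A * Real.sqrt B := by ring

/-- The SPLIT form of `lossBound_twoPiece`: `(η₂·√(2μ) + √2·η₂·η₁ + η₁)·√A·√B` — `η₂√(2μ)` carries the short-window gain
(`μ = Cmono·τ₂/R`), `√2·η₂·η₁` is harmless because `η₂` is CAPPED ((V_modEC), F-lead-g5-1). [folklore] -/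
theorem lossBound_twoPiece_split {U₁ T₁ U₂ T₂ : H →L[ℝ] H} {η₁ η₂ μ A B : ℝ} (hη₁ : 0 ≤ η₁) (hη₂ : 0 ≤ η₂) (hμ : 0 ≤ μ)
    (hT₁ : ∀ y, ‖T₁ y‖ ≤ ‖y‖) (hT₂ : ∀ y, ‖T₂ y‖ ≤ ‖y‖)
    (h₁ : ∀ x ζ : H, |⟪U₁ x - T₁ x, ζ⟫_ℝ| ≤ η₁ * Real.sqrt (‖x‖ ^ 2 - ‖T₁ x‖ ^ 2) * Real.sqrt (‖ζ‖ ^ 2 - ‖ContinuousLinearMap.adjoint T₁ ζ‖ ^ 2))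
    (h₂ : ∀ x ζ : H, |⟪U₂ x - T₂ x, ζ⟫_ℝ| ≤ η₂ * Real.sqrt (‖x‖ ^ 2 - ‖T₂ x‖ ^ 2) * Real.sqrt (‖ζ‖ ^ 2 - ‖ContinuousLinearMap.adjoint T₂ ζ‖ ^ 2))
    {x ζ : H} (hA : ‖x‖ ^ 2 - ‖(T₂.comp T₁) x‖ ^ 2 ≤ A)
    (hB : ‖ζ‖ ^ 2 - ‖ContinuousLinearMap.adjoint (T₂.comp T₁) ζ‖ ^ 2 ≤ B)
    (hmono : ‖T₁ x‖ ^ 2 - ‖T₂ (T₁ x)‖ ^ 2 ≤ μ * (‖x‖ ^ 2 - ‖T₁ x‖ ^ 2)) :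
    |⟪U₂ (U₁ x) - T₂ (T₁ x), ζ⟫_ℝ| ≤ (η₂ * Real.sqrt (2 * μ) + Real.sqrt 2 * η₂ * η₁ + η₁) * Real.sqrt A * Real.sqrt B := by
  have h := lossBound_twoPiece hη₁ hη₂ hμ hT₁ hT₂ h₁ h₂ hA hB hmono
  have hsplit : Real.sqrt (2 * μ + 2 * η₁ ^ 2) ≤ Real.sqrt (2 * μ) + Real.sqrt 2 * η₁ := by
    have h' := sqrt_add_le_sqrt_add_sqrt (a := 2 * μ) (b := 2 * η₁ ^ 2) (by positivity) (by positivity)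
    have h'' : Real.sqrt (2 * η₁ ^ 2) = Real.sqrt 2 * η₁ := by
      rw [Real.sqrt_mul (by norm_num : (0:ℝ) ≤ 2), Real.sqrt_sq hη₁]
    linarith
  have hAB : 0 ≤ Real.sqrt A * Real.sqrt B := mul_nonneg (Real.sqrt_nonneg _) (Real.sqrt_nonneg _)
  have hcoef : (η₂ * Real.sqrt (2 * μ + 2 * η₁ ^ 2) + η₁) ≤ (η₂ * Real.sqrt (2 * μ) + Real.sqrt 2 * η₂ * η₁ + η₁) := by
    have := mul_le_mul_of_nonneg_left hsplit hη₂
    linarith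
  calc |⟪U₂ (U₁ x) - T₂ (T₁ x), ζ⟫_ℝ| ≤ (η₂ * Real.sqrt (2 * μ + 2 * η₁ ^ 2) + η₁) * Real.sqrt A * Real.sqrt B := h
    _ = (η₂ * Real.sqrt (2 * μ + 2 * η₁ ^ 2) + η₁) * (Real.sqrt A * Real.sqrt B) := by ring
    _ ≤ (η₂ * Real.sqrt (2 * μ) + Real.sqrt 2 * η₂ * η₁ + η₁) * (Real.sqrt A * Real.sqrt B) := mul_le_mul_of_nonneg_right hcoef hAB
    _ = (η₂ * Real.sqrt (2 * μ) + Real.sqrt 2 * η₂ * η₁ + η₁) * Real.sqrt A * Real.sqrt B := by ring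

/-! ## §3 Reduction to the range of a self-adjoint contraction (divergence-free data) -/

/-- If `U` and `T` factor through a self-adjoint contraction `P` on both sides (`U = U∘P = P∘U`, `T = T∘P = P∘T`; e.g. the Leray
projection: both maps see only divergence-free data and have divergence-free range), a loss bound on the data `(P x, P ζ)` is a loss
bound on ALL data: `⟪(U−T)x, ζ⟫ = ⟪(U−T)Px, Pζ⟫`, `q_T(Px) ≤ q_T(x)`, `q*_T(Pζ) ≤ q*_T(ζ)`. [folklore] -/
theorem lossBound_of_range {U T P : H →L[ℝ] H} {η : ℝ} (hη : 0 ≤ η)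
    (hP : ∀ x, ‖P x‖ ≤ ‖x‖) (hPsa : ∀ x y : H, ⟪P x, y⟫_ℝ = ⟪x, P y⟫_ℝ)
    (hUP : U.comp P = U) (hTP : T.comp P = T) (hPU : P.comp U = U) (hPT : P.comp T = T)
    (h : ∀ x ζ : H, |⟪U (P x) - T (P x), P ζ⟫_ℝ|
      ≤ η * Real.sqrt (‖P x‖ ^ 2 - ‖T (P x)‖ ^ 2) * Real.sqrt (‖P ζ‖ ^ 2 - ‖ContinuousLinearMap.adjoint T (P ζ)‖ ^ 2))
    (x ζ : H) :
    |⟪U x - T x, ζ⟫_ℝ| ≤ η * Real.sqrt (‖x‖ ^ 2 - ‖T x‖ ^ 2) * Real.sqrt (‖ζ‖ ^ 2 - ‖ContinuousLinearMap.adjoint T ζ‖ ^ 2) := by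
  have hUx : U (P x) = U x := by rw [← ContinuousLinearMap.comp_apply, hUP]
  have hTx : T (P x) = T x := by rw [← ContinuousLinearMap.comp_apply, hTP]
  have hPadj : P = ContinuousLinearMap.adjoint P := (ContinuousLinearMap.eq_adjoint_iff P P).mpr hPsa
  have hTadj : ContinuousLinearMap.adjoint T (P ζ) = ContinuousLinearMap.adjoint T ζ := by
    have h1 : ContinuousLinearMap.adjoint T = (ContinuousLinearMap.adjoint T).comp P := by
      conv_lhs => rw [← hPT]
      rw [ContinuousLinearMap.adjoint_comp, ← hPadj]
    conv_rhs => rw [h1]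
    rfl
  -- move `P` across the pairing
  have hpair : ⟪U x - T x, ζ⟫_ℝ = ⟪U (P x) - T (P x), P ζ⟫_ℝ := by
    have hPd : P (U x - T x) = U x - T x := by
      rw [map_sub, ← ContinuousLinearMap.comp_apply, ← ContinuousLinearMap.comp_apply, hPU, hPT]
    rw [hUx, hTx, ← hPsa, hPd]
  -- the two loss monotonicities
  have hq : ‖P x‖ ^ 2 - ‖T (P x)‖ ^ 2 ≤ ‖x‖ ^ 2 - ‖T x‖ ^ 2 := by
    rw [hTx]; have := hP x; nlinarith [norm_nonneg (P x)]
  have hqs : ‖P ζ‖ ^ 2 - ‖ContinuousLinearMap.adjoint T (P ζ)‖ ^ 2 ≤ ‖ζ‖ ^ 2 - ‖ContinuousLinearMap.adjoint T ζ‖ ^ 2 := by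
    rw [hTadj]; have := hP ζ; nlinarith [norm_nonneg (P ζ)]
  rw [hpair]
  calc |⟪U (P x) - T (P x), P ζ⟫_ℝ| ≤ _ := h x ζ
    _ ≤ η * Real.sqrt (‖x‖ ^ 2 - ‖T x‖ ^ 2) * Real.sqrt (‖ζ‖ ^ 2 - ‖ContinuousLinearMap.adjoint T ζ‖ ^ 2) := by
        apply mul_le_mul (mul_le_mul_of_nonneg_left (Real.sqrt_le_sqrt hq) hη) (Real.sqrt_le_sqrt hqs) (Real.sqrt_nonneg _)
        exact mul_nonneg hη (Real.sqrt_nonneg _)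

/-! ## §4 Transfer along a frame conjugacy -/

/-- The three identities of `FrameConjugacyAt` (pairing, forward loss, adjoint loss) move a cell-side loss bound at `(x′, y′)` to the
Eulerian pair at `(x, y)` verbatim. [folklore] -/
theorem lossBound_transfer {H' : Type*} [NormedAddCommGroup H'] [InnerProductSpace ℝ H'] [CompleteSpace H']
    {U T : H →L[ℝ] H} {U' T' : H' →L[ℝ] H'} {η : ℝ} {x y : H} {x' y' : H'}
    (hid : ⟪U x - T x, y⟫_ℝ = ⟪U' x' - T' x', y'⟫_ℝ)
    (hq : ‖x'‖ ^ 2 - ‖T' x'‖ ^ 2 = ‖x‖ ^ 2 - ‖T x‖ ^ 2)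
    (hqs : ‖y'‖ ^ 2 - ‖ContinuousLinearMap.adjoint T' y'‖ ^ 2 = ‖y‖ ^ 2 - ‖ContinuousLinearMap.adjoint T y‖ ^ 2)
    (h' : |⟪U' x' - T' x', y'⟫_ℝ| ≤ η * Real.sqrt (‖x'‖ ^ 2 - ‖T' x'‖ ^ 2) * Real.sqrt (‖y'‖ ^ 2 - ‖ContinuousLinearMap.adjoint T' y'‖ ^ 2)) :
    |⟪U x - T x, y⟫_ℝ| ≤ η * Real.sqrt (‖x‖ ^ 2 - ‖T x‖ ^ 2) * Real.sqrt (‖y‖ ^ 2 - ‖ContinuousLinearMap.adjoint T y‖ ^ 2) := by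
  rw [hid, ← hq, ← hqs]
  exact h'

end Summit.AnomalousDissipation.AnomalousDissipation.Theorems.SolenoidalFractalHomogenisation.LagrangianStep.LossCurrency
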